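import Literature.Computability.AlgebraicComplexity.FewLetterEquations
import Literature.Computability.AlgebraicComplexity.HwvIdealDegreeCriterion
import Literature.Computability.AlgebraicComplexity.PaddedDeterminant
import Literature.Computability.AlgebraicComplexity.PaddedPermanentInheritance
import Literature.NumberTheory.DiophantineGeometry.SchurWeylPlethysmRenameProofs
import HarnessLib

/-!
# Padding blindness: below the first equation degree of `Δ_m(h)`, the orbit closure of the padded form
`x_t^e · h` has the fewest equations among all `x_t^e · h'`

Topic `Computability/AlgebraicComplexity` (geometric complexity theory).  Vocabulary of
`OrbitCoordinateRing.lean`, `GLHighestWeight.lean`, `SchurWeylPlethysm.lean`, `OrbitClosureInheritance.lean`: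
`orbitVanishingIdeal f m = I(GL_σ · f) ⊂ k[Sym^m k^σ]`, `orbitMultiplicity k f m χ = mult_χ k[Δ_m(f)]`,
`plethysmCoeff k σ m χ = a_χ`, weights `χ : Weight τ` of size `χ.size = -n·d` ⇔ degree `d` in `k[Sym^n]`.

**Setting.** `ι : σ → τ` is ANY injective placement of a small letter type in a big one (no
monotonicity: all weights below live on `τ`), `t ∉ range ι` a padding letter, `h, h' ∈ k[x_σ]` forms of
degree `m`, and `x_t^e · ι h ∈ k[x_τ]` the padded form of degree `m + e` — the shape of the padded
permanent `ℓ^{n-m} per_m ∈ S^n ℂ^{n²}` of Mulmuley–Sohoni / BLMW 2011 §6.3 / Kadish–Landsberg 2014.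
`IsEquationFreeUpTo h m d₀` says that `Δ_m(h) = \overline{GL_σ · h} ⊂ Sym^m k^σ` (the orbit closure in
its OWN letters) has no equations of degree `≤ d₀`; in characteristic zero this is "every type of degree
`≤ d₀` is full, `mult_χ = a_χ`" (`isEquationFreeUpTo_iff_forall_orbitMultiplicity_eq`, Bürgisser–Ikenmeyer
2013 Prop. 3.3 as proved in the tree's `HwvIdealDegreeCriterion.lean`).

**Theorems** (all proved; no named facts).
* §1 `mem_orbitVanishingIdeal_pad_iff` (infinite field): `F ∈ I(GL_τ · x_t^e ι h)` iff
  `F(ℓ^e · (g · ι h)) = 0` for every linear form `ℓ` and every `g ∈ GL_τ` — Kadish–Landsberg's "any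
  element `ℓ^{n-m} h ∈ F_{n-m}(S^nW^*)` is in the `GL(W)`-orbit of `(e₁)^{n-m} h̃`" (KL14 §2, first
  paragraph; Landsberg 2017, proof of Prop. 8.4.2.1), here through possibly SINGULAR column replacements,
  i.e. points of the endomorphism orbit, on which `I(GL · –)` vanishes
  (`aeval_formCoeff_linSubst_eq_zero_of_mem_orbitVanishingIdeal`).
* §2 `aeval_formCoeff_linSubstRep_rename_eq_zero_of_isEquationFreeUpTo`: if `Δ_m(h)` has no equations
  through degree `d₀`, every equation of degree `d ≤ d₀` of the BIG orbit closure `Δ_m(ι h)` vanishes at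
  `g · ι q` for EVERY `q ∈ k[x_σ]` — the pointwise content of "`I_d(\overline{GL_τ · ι h}) =
  I_d(Sub_{|σ|}(S^m k^τ))` for `d < e(h)`" (Landsberg 2017 Prop. 8.4.1.1 with BLMW 2011 Prop. 6.3.2),
  proved WITHOUT the dimension count: the restriction of `g⁻¹ · G` to the forms in the `ι`-letters is an
  equation of `Δ_m(h)` (test on the block-diagonal extensions `extendGL`), hence zero.
* §3 `orbitVanishingIdeal_pad_le_of_isEquationFreeUpTo` (**padding blindness, ideal form**): if `Δ_m(h)`
  has no equations through `d₀`, every equation of degree `d ≤ d₀` of `\overline{GL_τ · x_t^e ι h}` is an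
  equation of `\overline{GL_τ · x_t^e ι h'}` for EVERY form `h'` of degree `m` in the same letters;
  `mem_orbitVanishingIdeal_pad_iff_of_isEquationFreeUpTo`: equality when both are equation-free.
* §4 (A1) `orbitMultiplicity_pad_le_of_isEquationFreeUpTo` / `orbitMultiplicity_pad_eq_of_isEquationFreeUpTo`
  (characteristic zero, `m + e ≠ 0`): for weights `χ` of degree `d ≤ d₀`,
  `mult_χ k[Δ(x_t^e ι h')] ≤ mult_χ k[Δ(x_t^e ι h)]`, with equality when both forms are equation-free —
  below `e(h)` the multiplicities of a padded orbit closure do not see `h` (rank–nullity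
  `mult_χ + dim(HWV_χ ∩ I) = a_χ`, `orbitMultiplicity_add_finrank_inf_eq_plethysmCoeff`).
* §5 (A2) `orbitMultiplicity_pad_le_of_mem_orbitClosure`: if moreover `x_t^e ι h ∈ Δ_{m+e}(P)`, then
  `mult_χ k[Δ(x_t^e ι h')] ≤ mult_χ k[Δ_{m+e}(P)]` for every `h'` and every `χ` of degree `≤ d₀`: NO
  weight of degree `≤ d₀` is a multiplicity obstruction against `x_t^e ι h' ∈ Δ(P)`.  Only the
  equation-freeness of `h` (the form inside `Δ(P)`) is used.
* §6 (base field in `Type`): the multiplicity form of the hypothesis; the placement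
  `blockPlace : MatIdx n → MatIdx m` of the `n × n` letters as the bottom-right block; the tree's
  `paddedPerFormLex` / `paddedDetPoly` ARE `x₀₀^{m-n} · blockPlace(–)` (`paddedPerFormLex_eq_pad`,
  `rename_toLex_paddedDetPoly_eq_pad`); `pad_detFormLex_mem_orbitClosure_detFormLex`
  (`x₀₀^{m-n} det_n ∈ Δ(det_m)`, from `PaddedDeterminant.lean`); and the two instances
  `orbitMultiplicity_pad_le_detFormLex_of_forall_partition`,
  `orbitMultiplicity_paddedPerFormLex_le_detFormLex_of_forall_partition`: IF for every `d ≤ d₀` and every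
  `λ ⊢ n d` with `ℓ(λ) ≤ n²` one has `a_{λ*} ≤ mult_{λ*} k[Δ(det_n)]` (the `⟨n,n,d⟩` determinant columns
  are full through `d₀`, i.e. `e(det_n) > d₀` — a HYPOTHESIS, in the indexation of the tree's
  `orbitVanishingIdeal_det_degree_eq_zero_of_forall_partition`), THEN for every form `h'` of degree `n` on
  the `n × n` letters (in particular `x₀₀^{m-n} per_n = paddedPerFormLex k n m`) and every `λ ⊢ m d`,
  `d ≤ d₀`, `ℓ(λ) ≤ m²`: `mult_{λ*} k[Δ(x₀₀^{m-n} h')] ≤ mult_{λ*} k[Δ(det_m)]`.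

Written for the cell `pub-gct-max` (item 'lit1-padblind'; the cell's THEOREM V23 / R-L1 "padding
blindness", whose `(n, m, d₀) = (3, 4, 9)` instance — no multiplicity obstruction for `(x₀₀ · h', det₄)`
below degree `10 = e(det₃)`, `h'` any nine-letter cubic — is §6 with the measured record "`e(det₃) = 10`"
entering as the hypothesis).  Honest framing of that cell: multiplicity data and certified rank bounds at
small parameters; occurrence obstructions are ruled out in print (BIP'16) — multiplicity obstructions are
the open door; nothing here is a claim on VP vs VNP or P vs NP.  The statements of §1–§5 are assembled
from the printed parts cited at each declaration (KL14 §2 and Prop. 1.12, Landsberg 2017 Prop. 8.4.1.1 /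
§8.4.2, BLMW 2011 Prop. 6.3.2, BI13 Prop. 3.3, DIP20 §5); the assembled "padding blindness" statement
itself was not found in print (presearch recorded in the cell).  No named facts; the auxiliary
definitions `IsEquationFreeUpTo`, `padLinForm`, `blockPlace` are plumbing, `resCoord`/`mulCoord` private
proof devices.

## References

* [KadishLandsberg2014] H. Kadish, J. M. Landsberg, *Padded polynomials, their cousins, and geometric
  complexity theory*, Comm. Algebra 42 (2014) 2171–2180 = arXiv:1204.4693, §2 (proof of Thms 1.2/1.3,
  first paragraph: "any element `ℓ^{n-m}h` … is in the `GL(W)`-orbit of `(e₁)^{n-m}h̃`"), Prop. 1.12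
  (inheritance).
* [Landsberg2017] J. M. Landsberg, *Geometry and Complexity Theory*, CUP 2017, §8.4.1 Prop. 8.4.1.1
  (`I_δ(Sub_k(S^dV))`), §8.4.2 Prop. 8.4.2.1 (proof), Prop. 8.4.2.2 (padded cones).
* [BurgisserEtAl2011] P. Bürgisser, J. M. Landsberg, L. Manivel, J. Weyman, *An overview of mathematical
  issues arising in the geometric complexity theory approach to VP ≠ VNP*, SIAM J. Comput. 40 (2011),
  Prop. 6.3.2 and §6.3 (`ℓ^{n-m} per_m ∈ S^n ℂ^{m²+1}`).
* [BurgisserIkenmeyer2013] P. Bürgisser, C. Ikenmeyer, *Explicit lower bounds via geometric complexity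
  theory*, STOC 2013, §3.3 Prop. 3.3 (highest-weight vectors suffice).
* [DorflerIkenmeyerPanova2020] J. Dörfler, C. Ikenmeyer, G. Panova, SIAM J. Appl. Algebra Geom. 4 (2020),
  §5 (rank–nullity for multiplicities).
* [EfremenkoLandsbergSchenckWeyman2018] K. Efremenko, J. M. Landsberg, H. Schenck, J. Weyman, Math. Comp.
  87 (2018), §3 Case C1 (`x₀₀^{m-n} det_n ∈ End(W) · det_m`).
* [BLMW2011] = [BurgisserEtAl2011], (5.2.2) (types of `k[Sym^d(Sym^m)]` are partitions).

## Mathlib and tree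

Mathlib: `MvPolynomial.rename`, `coeff_rename_mapDomain`, `coeff_rename_eq_zero`, `Finsupp.mapDomain_support`,
`MvPolynomial.IsHomogeneous.aeval` / `.rename_isHomogeneous`, `Matrix.updateCol`, `Matrix.mulVec_mulVec`,
`AlgHom.map_det`, `Matrix.det_submatrix_equiv_self`, `Submodule.finrank_mono`.
Tree: `aeval_formCoeff_linSubst_eq_zero_of_mem_orbitVanishingIdeal` (`PowerSumLowDegreeIdeal.lean`);
`extendGL`, `linSubst_extendMatrix_rename`, `rename_mem_orbitVanishingIdeal_rename_iff`, `degIdxMap`,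
`exists_eq_degIdxMap` (`OrbitClosureInheritance.lean`, `NotViaSaturationsChowProofs.lean`);
`aeval_formCoeff_coordSubst`, `orbitVanishingIdeal_le_comap_coordSubst`, `sum_coeff_smul_monomial_eq`
(`OrbitCoordinateRing.lean`); `isHomogeneous_coordSubst`, `orbitVanishingIdeal_le_of_mem_orbitClosure`
(`GCTObstructions.lean`); `orbitMultiplicity_add_finrank_inf_eq_plethysmCoeff` (`HwvIdealRankBound.lean`);
`monWeight_eq_of_mem_weightSpace`, `size_monWeight`, `finiteDimensional_highestWeightSpace_coordRep_holds`;
`orbitVanishingIdeal_degree_eq_zero_iff`, `orbitVanishingIdeal_det_degree_eq_zero_of_forall_partition`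
(`HwvIdealDegreeCriterion.lean`); `paddedDetPoly_mem_orbitClosure_detPoly` (`PaddedDeterminant.lean`);
`blockEmb`, `blockEquiv` (`PaddedPermanentInheritance.lean`); `rename_perPoly_equiv`,
`rename_mem_orbitClosure_rename_iff_holds`, `size_toMatIdx_dualOfPartition`.
-/

noncomputable section

open MvPolynomial

namespace Literature.Computability.AlgebraicComplexity

open _root_.Literature.NumberTheory.DiophantineGeometry
open _root_.Literature.Barriers.ValiantsHypothesis (degIdxMap degIdxMap_val degIdxMap_injective
  exists_eq_degIdxMap)

variable {k : Type*} [Field k] {σ τ : Type*} [Fintype σ] [LinearOrder σ] [Fintype τ]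
  [LinearOrder τ] {ι : σ → τ}

/-! ### §0 The hypothesis: an orbit closure with no equations through degree `d₀` -/

/-- `IsEquationFreeUpTo f m d₀`: the orbit closure `Δ_m(f) = \overline{GL_σ · f} ⊂ Sym^m k^σ` has NO
equations of degree `≤ d₀` — every polynomial in the degree-`m` coefficients, homogeneous of some degree
`d ≤ d₀`, that vanishes on `GL_σ · f` is zero; equivalently (`isEquationFreeUpTo_iff_forall_orbitMultiplicity_eq`)
every type of degree `≤ d₀` is FULL: `mult_χ k[Δ_m(f)] = a_χ`.  For the cell: `e(f) > d₀`, "the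
`⟨m,m,d⟩` columns are complete and FULL for `d ≤ d₀`" (records R1: `det₃`, `d₀ = 9`; R2: `per₃`, `d₀ = 12`).
[cite: BurgisserIkenmeyer2013, §3.3 Prop. 3.3] -/
def IsEquationFreeUpTo (f : MvPolynomial σ k) (m d₀ : ℕ) : Prop :=
  ∀ ⦃d : ℕ⦄, d ≤ d₀ → ∀ ⦃Ψ : MvPolynomial (DegIdx σ m) k⦄,
    Ψ ∈ orbitVanishingIdeal f m → Ψ.IsHomogeneous d → Ψ = 0

/-- The hypothesis descends along any injective renaming of the letters (the big orbit closure has at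
least the renamed equations, `rename_mem_orbitVanishingIdeal_rename_iff`). [cite: BurgisserEtAl2011, Prop. 6.3.2 (proof)] -/
theorem IsEquationFreeUpTo.of_rename [Infinite k] (hι : Function.Injective ι)
    {f : MvPolynomial σ k} {m d₀ : ℕ} (h : IsEquationFreeUpTo (rename ι f) m d₀) :
    IsEquationFreeUpTo f m d₀ := by
  intro d hd Ψ hΨ hΨd
  have h1 : rename (degIdxMap hι) Ψ ∈ orbitVanishingIdeal (rename ι f) m :=
    (rename_mem_orbitVanishingIdeal_rename_iff hι f Ψ).mpr hΨ
  have h2 := h hd h1 (hΨd.rename_isHomogeneous (f := degIdxMap hι))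
  exact rename_injective _ (degIdxMap_injective hι) (by rw [h2, map_zero])

/-! ### §1 The orbit of a padded form: `GL_τ · (x_t^e · h) ∼ {ℓ^e · (g · h)}` (KL14 §2) -/

section Pad

/-- The linear form with coefficient vector `c`: `∑_x c_x X_x`. [folklore] -/
def padLinForm (c : τ → k) : MvPolynomial τ k := ∑ x, c x • X x

omit [Fintype σ] [LinearOrder σ] [LinearOrder τ] in
/-- A linear substitution sends a variable to a linear form: `A · x_t = ∑_j A_{jt} x_j`. [folklore] -/
private theorem linSubst_X_eq_padLinForm (A : Matrix τ τ k) (t : τ) :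
    linSubst τ k A (X t) = padLinForm (fun j => A j t) := by
  rw [linSubst_X]; rfl

omit [Fintype σ] [LinearOrder σ] [LinearOrder τ] in
/-- Linear substitution of a linear form: `A · ℓ_c = ℓ_{A c}`. [folklore] -/
private theorem linSubst_padLinForm (A : Matrix τ τ k) (c : τ → k) :
    linSubst τ k A (padLinForm c) = padLinForm (A.mulVec c) := by
  simp only [padLinForm, map_sum, map_smul, linSubst_X, Finset.smul_sum, smul_smul]
  rw [Finset.sum_comm]
  refine Finset.sum_congr rfl fun j _ => ?_
  rw [← Finset.sum_smul, Matrix.mulVec, dotProduct]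
  refine congrArg (fun a : k => a • (X j : MvPolynomial τ k)) (Finset.sum_congr rfl fun x _ => ?_)
  exact mul_comm _ _

omit [Fintype σ] [LinearOrder σ] [LinearOrder τ] in
/-- The column-`t` replacement matrix `1[t ↦ c']` fixes every other variable. [folklore] -/
private theorem linSubst_updateCol_X_of_ne [DecidableEq τ] (t : τ) (c' : τ → k) {y : τ} (hy : y ≠ t) :
    linSubst τ k ((1 : Matrix τ τ k).updateCol t c') (X y) = X y := by
  rw [linSubst_X]
  simp only [Matrix.updateCol_apply, if_neg hy, Matrix.one_apply, ite_smul, one_smul, zero_smul]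
  rw [Finset.sum_ite_eq' Finset.univ y, if_pos (Finset.mem_univ _)]

omit [Fintype σ] [LinearOrder σ] [LinearOrder τ] in
/-- … and sends `x_t` to the linear form `ℓ_{c'}`. [folklore] -/
private theorem linSubst_updateCol_X_self [DecidableEq τ] (t : τ) (c' : τ → k) :
    linSubst τ k ((1 : Matrix τ τ k).updateCol t c') (X t) = padLinForm c' := by
  rw [linSubst_X_eq_padLinForm]
  refine congrArg padLinForm (funext fun j => ?_)
  rw [Matrix.updateCol_apply, if_pos rfl]

omit [Fintype σ] [LinearOrder σ] [LinearOrder τ] in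
/-- A substitution fixing the `ι`-letters fixes every polynomial in the `ι`-letters. [folklore] -/
private theorem linSubst_rename_eq_self_of_forall {A : Matrix τ τ k}
    (hA : ∀ j : σ, linSubst τ k A (X (ι j)) = X (ι j)) (q : MvPolynomial σ k) :
    linSubst τ k A (rename ι q) = rename ι q := by
  suffices hcomp : (linSubst τ k A).comp (rename ι) = rename ι from congrArg (fun φ => φ q) hcomp
  apply MvPolynomial.algHom_ext
  intro j
  rw [AlgHom.comp_apply, rename_X, hA j]

omit [Fintype σ] [LinearOrder σ] [LinearOrder τ] in
/-- **The orbit point of a padded form**: `g · (x_t^e · ι h) = (g x_t)^e · (g · ι h)`. [folklore] -/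
private theorem linSubst_pad (A : Matrix τ τ k) (t : τ) (e : ℕ) (h : MvPolynomial σ k) :
    linSubst τ k A (X t ^ e * rename ι h) =
      padLinForm (fun j => A j t) ^ e * linSubst τ k A (rename ι h) := by
  rw [map_mul, map_pow, linSubst_X_eq_padLinForm]

omit [Fintype σ] [LinearOrder σ] in
/-- **Every product `ℓ_c^e · (g · ι h)` is an endomorphism translate of the padded form**:
`(g · 1[t ↦ g⁻¹ c]) · (x_t^e · ι h) = ℓ_c^e · (g · ι h)` (`t ∉ range ι`). [folklore] -/
private theorem linSubst_mul_updateCol_pad {t : τ} (ht : t ∉ Set.range ι)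
    (h : MvPolynomial σ k) (e : ℕ) (c : τ → k) (g : GL τ k) :
    linSubst τ k ((g : Matrix τ τ k) * (1 : Matrix τ τ k).updateCol t (((g⁻¹ : GL τ k) : Matrix τ τ k).mulVec c))
        (X t ^ e * rename ι h) =
      padLinForm c ^ e * linSubstRep τ k g (rename ι h) := by
  classical
  rw [linSubst_mul, AlgHom.comp_apply, map_mul, map_pow, linSubst_updateCol_X_self,
    linSubst_rename_eq_self_of_forall (fun j => linSubst_updateCol_X_of_ne t _ (fun hj => ht ⟨j, hj⟩)),
    map_mul, map_pow, linSubst_padLinForm, Matrix.mulVec_mulVec, ← Units.val_mul, mul_inv_cancel,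
    Units.val_one, Matrix.one_mulVec, linSubstRep_apply]

omit [Fintype σ] [LinearOrder σ] in
/-- **Equations of the orbit of a padded form are tested on products `ℓ^e · (g · h)`**
(infinite field; `t ∉ range ι`, so `x_t` is a letter foreign to `h`): a polynomial `F` in the
degree-`(m+e)` coefficients vanishes on `GL_τ · (x_t^e · ι h)` iff `F(ℓ^e · (g · ι h)) = 0` for EVERY
linear form `ℓ` and every `g ∈ GL_τ`.  (`⇐`: `g · (x_t^e ι h) = (g x_t)^e (g · ι h)`; `⇒`: `ℓ^e (g · ι h)
= (g M_ℓ) · (x_t^e ι h)` for the matrix `M_ℓ` replacing the column `t` of `1` by `g⁻¹ ℓ` — possibly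
SINGULAR, a point of `End · (x_t^e ι h)`, on which `I(GL · –)` vanishes, tree
`aeval_formCoeff_linSubst_eq_zero_of_mem_orbitVanishingIdeal`.)  Kadish–Landsberg: "any element
`ℓ^{n-m} h ∈ F_{n-m}(S^n W^*)` is in the `GL(W)`-orbit of `(e₁)^{n-m} h̃`".
[cite: KadishLandsberg2014, §2 (proof of Thms 1.2/1.3, first paragraph)] -/
theorem mem_orbitVanishingIdeal_pad_iff [Infinite k] {t : τ} (ht : t ∉ Set.range ι)
    (h : MvPolynomial σ k) (m e : ℕ) (F : MvPolynomial (DegIdx τ (m + e)) k) :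
    F ∈ orbitVanishingIdeal (X t ^ e * rename ι h) (m + e) ↔
      ∀ (c : τ → k) (g : GL τ k),
        aeval (formCoeff (m + e) (padLinForm c ^ e * linSubstRep τ k g (rename ι h))) F = 0 := by
  classical
  constructor
  · intro hF c g
    rw [← linSubst_mul_updateCol_pad ht h e c g]
    exact aeval_formCoeff_linSubst_eq_zero_of_mem_orbitVanishingIdeal hF _
  · intro H
    rw [mem_orbitVanishingIdeal_iff]
    intro g
    rw [linSubstRep_apply, linSubst_pad, ← linSubstRep_apply]
    exact H _ g

end Pad

/-! ### §2 Low-degree equations of `Δ_m(ι h)` vanish on every form in the letters of `h`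
(Landsberg 2017 Prop. 8.4.1.1: below `e(h)` the equations of `\overline{GL_τ · ι h}` are those of `Sub_{|σ|}`) -/

section Restrict

variable {m : ℕ}

/-- **Restriction of a polynomial function on `Sym^m k^τ` to the forms in the `ι`-letters**
(a proof device): the coordinate `X_E` goes to `X_e` if `E = ι(e)` is a monomial in the `ι`-letters
and to `0` otherwise. [folklore] -/
private def resCoord (hι : Function.Injective ι) (m : ℕ) :
    MvPolynomial (DegIdx τ m) k →ₐ[k] MvPolynomial (DegIdx σ m) k :=
  aeval (Function.extend (degIdxMap (m := m) hι) X 0)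

/-- A monomial of `rename ι q` is a monomial in the `ι`-letters. [folklore] -/
private theorem mem_range_degIdxMap_of_coeff_rename_ne_zero (hι : Function.Injective ι) (q : MvPolynomial σ k) {E : DegIdx τ m}
    (hE : coeff E.1 (rename ι q) ≠ 0) : E ∈ Set.range (degIdxMap (m := m) hι) := by
  classical
  by_contra hnot
  apply hE
  apply coeff_rename_eq_zero
  intro u hu
  exfalso
  apply hnot
  have hsub : (↑E.1.support : Set τ) ⊆ Set.range ι := by
    intro x hx
    rw [← hu] at hx
    have hx' := Finsupp.mapDomain_support (Finset.mem_coe.mp hx)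
    obtain ⟨y, -, rfl⟩ := Finset.mem_image.mp hx'
    exact ⟨y, rfl⟩
  obtain ⟨e, he⟩ := exists_eq_degIdxMap hι hsub
  exact ⟨e, he⟩

/-- **Evaluating at a form in the `ι`-letters is evaluating the restriction**:
`G(ι q) = (res G)(q)`. [folklore] -/
private theorem aeval_formCoeff_rename_eq_resCoord (hι : Function.Injective ι) (q : MvPolynomial σ k)
    (G : MvPolynomial (DegIdx τ m) k) :
    aeval (formCoeff m (rename ι q)) G = aeval (formCoeff m q) (resCoord (k := k) hι m G) := by
  suffices hcomp : aeval (formCoeff m (rename ι q)) =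
      (aeval (formCoeff m q)).comp (resCoord (k := k) hι m) from congrArg (fun φ => φ G) hcomp
  apply MvPolynomial.algHom_ext
  intro E
  rw [AlgHom.comp_apply, aeval_X, formCoeff_apply, resCoord, aeval_X]
  by_cases hE : E ∈ Set.range (degIdxMap (m := m) hι)
  · obtain ⟨e, rfl⟩ := hE
    rw [(degIdxMap_injective hι).extend_apply, aeval_X, formCoeff_apply, degIdxMap_val,
      coeff_rename_mapDomain ι hι]
  · rw [Function.extend_apply' _ _ _ (fun ⟨e, he⟩ => hE ⟨e, he⟩), Pi.zero_apply, map_zero]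
    by_contra hne
    exact hE (mem_range_degIdxMap_of_coeff_rename_ne_zero hι q hne)

/-- The restriction preserves homogeneity (each coordinate goes to a coordinate or to `0`). [folklore] -/
private theorem resCoord_isHomogeneous (hι : Function.Injective ι) {G : MvPolynomial (DegIdx τ m) k}
    {d : ℕ} (hG : G.IsHomogeneous d) : (resCoord (k := k) hι m G).IsHomogeneous d := by
  have hg : ∀ E : DegIdx τ m,
      (Function.extend (degIdxMap (m := m) hι) X 0 E : MvPolynomial (DegIdx σ m) k).IsHomogeneous 1 := by
    intro E
    by_cases hE : E ∈ Set.range (degIdxMap (m := m) hι)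
    · obtain ⟨e, rfl⟩ := hE
      rw [(degIdxMap_injective hι).extend_apply]
      exact isHomogeneous_X k e
    · rw [Function.extend_apply' _ _ _ (fun ⟨e, he⟩ => hE ⟨e, he⟩), Pi.zero_apply]
      exact isHomogeneous_zero _ _ _
  have h := hG.aeval _ hg
  rw [one_mul] at h
  exact h

/-- **The restriction of an equation of `Δ_m(ι h)` is an equation of `Δ_m(h)`** (test on the
block-diagonal extensions `extendGL g`, `g ∈ GL_σ`: `ι(g · h) = extendGL(g) · ι h`).
[cite: BurgisserEtAl2011, Prop. 6.3.2 (proof)] -/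
private theorem resCoord_mem_orbitVanishingIdeal (hι : Function.Injective ι) {h : MvPolynomial σ k}
    {G : MvPolynomial (DegIdx τ m) k} (hG : G ∈ orbitVanishingIdeal (rename ι h) m) :
    resCoord (k := k) hι m G ∈ orbitVanishingIdeal h m := by
  rw [mem_orbitVanishingIdeal_iff]
  intro g
  rw [← aeval_formCoeff_rename_eq_resCoord, linSubstRep_apply, ← linSubst_extendMatrix_rename hι,
    ← coe_extendGL, ← linSubstRep_apply]
  exact mem_orbitVanishingIdeal_iff.mp hG _

end Restrict

/-- **A degree-`d ≤ d₀` equation of the big orbit closure `Δ_m(ι h)` vanishes at `g · ι q` for EVERY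
`q ∈ k[x_σ]` and every `g ∈ GL_τ`** when `Δ_m(h)` has no equations through degree `d₀`: the
restriction of `g⁻¹ · G` to the forms in the `ι`-letters is an equation of `Δ_m(h)` of degree `d`
(tested through the block-diagonal extension `extendGL`), hence zero.  This is the pointwise content of
"`I_d(\overline{GL·ι h}) = I_d(Sub_{|σ|}(S^m k^τ))` for `d < e(h)`" (Landsberg 2017 Prop. 8.4.1.1 with
BLMW Prop. 6.3.2). [cite: Landsberg2017, Prop. 8.4.1.1] -/
theorem aeval_formCoeff_linSubstRep_rename_eq_zero_of_isEquationFreeUpTo [Infinite k]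
    (hι : Function.Injective ι) {h : MvPolynomial σ k} {m d₀ d : ℕ} (hE : IsEquationFreeUpTo h m d₀)
    (hd : d ≤ d₀) {G : MvPolynomial (DegIdx τ m) k} (hG : G ∈ orbitVanishingIdeal (rename ι h) m)
    (hGd : G.IsHomogeneous d) (g : GL τ k) (q : MvPolynomial σ k) :
    aeval (formCoeff m (linSubstRep τ k g (rename ι q))) G = 0 := by
  have h1 : coordSubst m g⁻¹ G ∈ orbitVanishingIdeal (rename ι h) m :=
    orbitVanishingIdeal_le_comap_coordSubst _ m g⁻¹ hG
  have h2 : (coordSubst m g⁻¹ G).IsHomogeneous d := isHomogeneous_coordSubst g⁻¹ hGd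
  have h3 := aeval_formCoeff_coordSubst m g⁻¹ (rename ι q) G
  rw [inv_inv] at h3
  rw [← h3, aeval_formCoeff_rename_eq_resCoord hι, hE hd (resCoord_mem_orbitVanishingIdeal hι h1)
    (resCoord_isHomogeneous hι h2), map_zero]

/-! ### §3 Padding blindness for the ideals -/

section MulCoord

variable {m e : ℕ}

omit [Fintype σ] [LinearOrder σ] in
/-- **Composition with multiplication by a fixed polynomial `P`** (a proof device): the algebra map
`k[Sym^{m+e} k^τ] → k[Sym^m k^τ]`, `F ↦ (q ↦ F(P · q))`, substituting for the coordinate `X_D` the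
linear form `∑_E coeff_D(P · x^E) X_E`. [folklore] -/
private def mulCoord (m e : ℕ) (P : MvPolynomial τ k) :
    MvPolynomial (DegIdx τ (m + e)) k →ₐ[k] MvPolynomial (DegIdx τ m) k :=
  aeval fun D => ∑ E : DegIdx τ m, coeff D.1 (P * monomial E.1 1) • X E

omit [Fintype σ] [LinearOrder σ] in
/-- **Evaluation**: `(mulCoord P F)(q) = F(P · q)` for `q` a form of degree `m` (its degree-`m`
coefficients determine `q`, and `q ↦ coeff_D (P · q)` is linear). [folklore] -/
private theorem aeval_formCoeff_mulCoord (P : MvPolynomial τ k) {q : MvPolynomial τ k}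
    (hq : q.IsHomogeneous m) (F : MvPolynomial (DegIdx τ (m + e)) k) :
    aeval (formCoeff m q) (mulCoord m e P F) = aeval (formCoeff (m + e) (P * q)) F := by
  suffices hcomp : (aeval (formCoeff m q)).comp (mulCoord (k := k) m e P) =
      aeval (formCoeff (m + e) (P * q)) from congrArg (fun φ => φ F) hcomp
  apply MvPolynomial.algHom_ext
  intro D
  rw [AlgHom.comp_apply, aeval_X, formCoeff_apply, mulCoord, aeval_X, map_sum]
  simp only [map_smul, aeval_X, formCoeff_apply, smul_eq_mul]
  conv_rhs => rw [← sum_coeff_smul_monomial_eq hq, Finset.mul_sum, coeff_sum]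
  refine Finset.sum_congr rfl fun E _ => ?_
  rw [mul_smul_comm, coeff_smul, smul_eq_mul, mul_comm]

omit [Fintype σ] [LinearOrder σ] in
/-- `mulCoord P` preserves homogeneity (a linear substitution of coordinates). [folklore] -/
private theorem mulCoord_isHomogeneous (P : MvPolynomial τ k) {F : MvPolynomial (DegIdx τ (m + e)) k}
    {d : ℕ} (hF : F.IsHomogeneous d) : (mulCoord (k := k) m e P F).IsHomogeneous d := by
  have hg : ∀ D : DegIdx τ (m + e),
      (∑ E : DegIdx τ m, coeff D.1 (P * monomial E.1 1) • (X E : MvPolynomial (DegIdx τ m) k)).IsHomogeneous 1 :=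
    fun D => IsHomogeneous.sum _ _ 1 fun E _ => by
      rw [smul_eq_C_mul]
      exact (isHomogeneous_X k E).C_mul _
  have h := hF.aeval _ hg
  rw [one_mul] at h
  exact h

end MulCoord

/-- **Padding blindness (ideal form).**  Let `h, h' ∈ k[x_σ]` be forms of degree `m`, placed by an
injective `ι : σ → τ` in a bigger letter type, `x_t` (`t ∉ range ι`) a fresh letter, `e` a padding
exponent, `k` infinite.  If `Δ_m(h)` has no equations through degree `d₀`, then every equation of degree
`d ≤ d₀` of `\overline{GL_τ · x_t^e ι h}` is an equation of `\overline{GL_τ · x_t^e ι h'}` — for EVERY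
form `h'` of degree `m` in the same letters (no hypothesis on `h'`).  Proof: §1 turns the equation `F`
into the family `G_ℓ = F(ℓ^e · –)` of degree-`d` equations of `Δ_m(ι h)`, §2 makes each `G_ℓ` vanish
at every `g · ι h'`, §1 backwards.  Cell reading (V23 step (3), R-L1 (3)): through degree `e(h) - 1`
the padded orbit closure `Z_h` has the FEWEST equations among all `Z_{h'}`, i.e. `I(Z_h)_d = I(Y)_d`.
[cite: KadishLandsberg2014, Prop. 1.12 and §2] [cite: Landsberg2017, Prop. 8.4.1.1 and §8.4.2] -/
theorem orbitVanishingIdeal_pad_le_of_isEquationFreeUpTo [Infinite k] (hι : Function.Injective ι)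
    {t : τ} (ht : t ∉ Set.range ι) {m e d₀ : ℕ} {h h' : MvPolynomial σ k} (hh : h.IsHomogeneous m)
    (hh' : h'.IsHomogeneous m) (hE : IsEquationFreeUpTo h m d₀) {d : ℕ} (hd : d ≤ d₀)
    {F : MvPolynomial (DegIdx τ (m + e)) k} (hFd : F.IsHomogeneous d)
    (hF : F ∈ orbitVanishingIdeal (X t ^ e * rename ι h) (m + e)) :
    F ∈ orbitVanishingIdeal (X t ^ e * rename ι h') (m + e) := by
  rw [mem_orbitVanishingIdeal_pad_iff ht]
  intro c g
  -- the degree-`d` test polynomial `G_c = F(ℓ_c^e · –)` on `Sym^m k^τ`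
  have hGd : (mulCoord (k := k) m e (padLinForm c ^ e) F).IsHomogeneous d := mulCoord_isHomogeneous _ hFd
  have hG : mulCoord (k := k) m e (padLinForm c ^ e) F ∈ orbitVanishingIdeal (rename ι h) m := by
    rw [mem_orbitVanishingIdeal_iff]
    intro g'
    rw [aeval_formCoeff_mulCoord _ (by
      rw [linSubstRep_apply]; exact linSubst_isHomogeneous _ (hh.rename_isHomogeneous (f := ι)))]
    exact (mem_orbitVanishingIdeal_pad_iff ht h m e F).mp hF c g'
  have hq : (linSubstRep τ k g (rename ι h')).IsHomogeneous m := by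
    rw [linSubstRep_apply]; exact linSubst_isHomogeneous _ (hh'.rename_isHomogeneous (f := ι))
  rw [← aeval_formCoeff_mulCoord (padLinForm c ^ e) hq F]
  exact aeval_formCoeff_linSubstRep_rename_eq_zero_of_isEquationFreeUpTo hι hE hd hG hGd g h'

/-- Symmetric form: if BOTH `Δ_m(h)` and `Δ_m(h')` are equation-free through degree `d₀`, the two padded
orbit closures have the SAME equations of every degree `d ≤ d₀` (V23 step (3): `I(Z_{per₃})_d =
I(Z_{det₃})_d` for `d ≤ 9`). [cite: KadishLandsberg2014, Prop. 1.12 and §2] -/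
theorem mem_orbitVanishingIdeal_pad_iff_of_isEquationFreeUpTo [Infinite k] (hι : Function.Injective ι)
    {t : τ} (ht : t ∉ Set.range ι) {m e d₀ : ℕ} {h h' : MvPolynomial σ k} (hh : h.IsHomogeneous m)
    (hh' : h'.IsHomogeneous m) (hE : IsEquationFreeUpTo h m d₀) (hE' : IsEquationFreeUpTo h' m d₀)
    {d : ℕ} (hd : d ≤ d₀) {F : MvPolynomial (DegIdx τ (m + e)) k} (hFd : F.IsHomogeneous d) :
    F ∈ orbitVanishingIdeal (X t ^ e * rename ι h) (m + e) ↔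
      F ∈ orbitVanishingIdeal (X t ^ e * rename ι h') (m + e) :=
  ⟨orbitVanishingIdeal_pad_le_of_isEquationFreeUpTo hι ht hh hh' hE hd hFd,
    orbitVanishingIdeal_pad_le_of_isEquationFreeUpTo hι ht hh' hh hE' hd hFd⟩

/-! ### §4 Padding blindness for the multiplicities (A1) -/

/-- A highest-weight vector of `k[Sym^n k^τ]` of weight `χ` with `|χ| = -n d` (`n ≠ 0`) is homogeneous
of degree `d`: all its monomials have torus weight `χ` (`monWeight_eq_of_mem_weightSpace`), and a
monomial of degree `d'` has weight of size `-n d'` (`size_monWeight`) — "a weight pins the degree"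
(BLMW 2011 §4.4; the tree's `isHomogeneous_of_mem_weightSpace_of_size_eq`, restated universe
polymorphically). [folklore] -/
private theorem isHomogeneous_of_mem_highestWeightSpace_of_size_eq [Infinite k] {n d : ℕ} (hn : n ≠ 0)
    {χ : Weight τ} (hχ : χ.size = -((n * d : ℕ) : ℤ)) {F : MvPolynomial (DegIdx τ n) k}
    (hF : F ∈ highestWeightSpace (coordRep τ k n) χ) : F.IsHomogeneous d := by
  classical
  have hF' := highestWeightSpace_le_weightSpace _ _ hF
  intro s hs
  have hs' : s ∈ F.support := MvPolynomial.mem_support_iff.mpr hs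
  have hw := monWeight_eq_of_mem_weightSpace hF' hs'
  have hsize := size_monWeight s
  rw [hw, hχ] at hsize
  have hdeg : s.degree = d := by
    have h1 : ((n * d : ℕ) : ℤ) = ((n * s.degree : ℕ) : ℤ) := neg_injective hsize
    have h2 : n * d = n * s.degree := by exact_mod_cast h1
    exact (Nat.eq_of_mul_eq_mul_left (Nat.pos_of_ne_zero hn) h2).symm
  rw [← hdeg, Finsupp.degree_eq_weight_one]
  rfl

/-- **Fewer equations, larger multiplicities**: if every highest-weight EQUATION of weight `χ` of
`Δ_n(p)` is one of `Δ_n(p')` (an inclusion `HWV_χ ∩ I(GL·p) ⊆ HWV_χ ∩ I(GL·p')`), then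
`mult_χ k[Δ_n(p')] ≤ mult_χ k[Δ_n(p)]` — rank–nullity `mult_χ + dim(HWV_χ ∩ I) = a_χ` on both sides
(characteristic zero, `n ≠ 0`). [cite: DorflerIkenmeyerPanova2020, §5] -/
theorem orbitMultiplicity_le_of_hwv_inf_le [CharZero k] {n : ℕ} (hn : n ≠ 0) {p p' : MvPolynomial τ k}
    {χ : Weight τ}
    (hle : highestWeightSpace (coordRep τ k n) χ ⊓ (orbitVanishingIdeal p n).restrictScalars k ≤
      highestWeightSpace (coordRep τ k n) χ ⊓ (orbitVanishingIdeal p' n).restrictScalars k) :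
    orbitMultiplicity k p' n χ ≤ orbitMultiplicity k p n χ := by
  haveI : Infinite k := CharZero.infinite k
  haveI : FiniteDimensional k (highestWeightSpace (coordRep τ k n) χ) :=
    finiteDimensional_highestWeightSpace_coordRep_holds hn χ
  haveI : Module.Finite k
      ↥(highestWeightSpace (coordRep τ k n) χ ⊓ (orbitVanishingIdeal p' n).restrictScalars k) :=
    Module.Finite.of_injective (Submodule.inclusion
      (inf_le_left : highestWeightSpace (coordRep τ k n) χ ⊓
        (orbitVanishingIdeal p' n).restrictScalars k ≤ _)) (Submodule.inclusion_injective _)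
  have h1 := orbitMultiplicity_add_finrank_inf_eq_plethysmCoeff p hn χ
  have h2 := orbitMultiplicity_add_finrank_inf_eq_plethysmCoeff p' hn χ
  have h3 := Submodule.finrank_mono hle
  omega

/-- **(A1, one-sided) Padding blindness for multiplicities.**  Characteristic zero; `h, h'` forms of
degree `m` in the letters `σ`, `ι : σ → τ` injective, `t ∉ range ι`, `m + e ≠ 0`.  If `Δ_m(h)` has no
equations through degree `d₀`, then for every weight `χ` of `GL_τ` of degree `d ≤ d₀`
(`|χ| = -(m+e) d`): `mult_χ k[\overline{GL_τ · x_t^e ι h'}] ≤ mult_χ k[\overline{GL_τ · x_t^e ι h}]`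
(rank–nullity `mult_χ + dim(HWV_χ ∩ I) = a_χ` on both sides, §3, and "a weight pins the degree").
[cite: KadishLandsberg2014, Prop. 1.12 and §2] [cite: BurgisserEtAl2011, Prop. 6.3.2] -/
theorem orbitMultiplicity_pad_le_of_isEquationFreeUpTo [CharZero k] (hι : Function.Injective ι)
    {t : τ} (ht : t ∉ Set.range ι) {m e d₀ : ℕ} (hme : m + e ≠ 0) {h h' : MvPolynomial σ k}
    (hh : h.IsHomogeneous m) (hh' : h'.IsHomogeneous m) (hE : IsEquationFreeUpTo h m d₀)
    {d : ℕ} (hd : d ≤ d₀) {χ : Weight τ} (hχ : χ.size = -(((m + e) * d : ℕ) : ℤ)) :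
    orbitMultiplicity k (X t ^ e * rename ι h') (m + e) χ ≤
      orbitMultiplicity k (X t ^ e * rename ι h) (m + e) χ := by
  haveI : Infinite k := CharZero.infinite k
  refine orbitMultiplicity_le_of_hwv_inf_le hme fun F hF => ⟨hF.1, ?_⟩
  have hFd : F.IsHomogeneous d := isHomogeneous_of_mem_highestWeightSpace_of_size_eq hme hχ hF.1
  exact orbitVanishingIdeal_pad_le_of_isEquationFreeUpTo hι ht hh hh' hE hd hFd hF.2

/-- **(A1) The multiplicities of a padded orbit closure in low degree do not see `h`.**  If both
`Δ_m(h)` and `Δ_m(h')` are equation-free through degree `d₀` then, for every weight `χ` of degree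
`d ≤ d₀`, `k[\overline{GL_τ · x_t^e ι h}]` and `k[\overline{GL_τ · x_t^e ι h'}]` have the same
`χ`-multiplicity: in this range the multiplicities do not depend on the (equation-free) form `h` of
degree `m` in the letters `σ`.  Cell reading (THEOREM V23 /
R-L1): `K_{Z_{per₃}}(λ; d) = K_{Z_{det₃}}(λ; d)` for every `λ` and `d ≤ 9 = min(e(per₃), e(det₃)) - 1`.
[cite: KadishLandsberg2014, Prop. 1.12 and §2] [cite: BurgisserEtAl2011, Prop. 6.3.2] -/
theorem orbitMultiplicity_pad_eq_of_isEquationFreeUpTo [CharZero k] (hι : Function.Injective ι)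
    {t : τ} (ht : t ∉ Set.range ι) {m e d₀ : ℕ} (hme : m + e ≠ 0) {h h' : MvPolynomial σ k}
    (hh : h.IsHomogeneous m) (hh' : h'.IsHomogeneous m) (hE : IsEquationFreeUpTo h m d₀)
    (hE' : IsEquationFreeUpTo h' m d₀) {d : ℕ} (hd : d ≤ d₀) {χ : Weight τ}
    (hχ : χ.size = -(((m + e) * d : ℕ) : ℤ)) :
    orbitMultiplicity k (X t ^ e * rename ι h) (m + e) χ =
      orbitMultiplicity k (X t ^ e * rename ι h') (m + e) χ :=
  le_antisymm (orbitMultiplicity_pad_le_of_isEquationFreeUpTo hι ht hme hh' hh hE' hd hχ)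
    (orbitMultiplicity_pad_le_of_isEquationFreeUpTo hι ht hme hh hh' hE hd hχ)

/-! ### §5 (A2) No multiplicity obstruction below `e(h)` against any orbit closure containing `x_t^e ι h` -/

/-- **(A2) Padding blindness kills low-degree multiplicity obstructions.**  Characteristic zero; notation
of (A1).  If `Δ_m(h)` has no equations through degree `d₀` and the padded form `x_t^e ι h` lies in the
orbit closure `Δ_{m+e}(P)` of some `P ∈ k[x_τ]` (e.g. `h = det_n`, `P = det_m`, `x₀₀^{m-n} det_n =
det_m(diag(x₀₀ I, X))`), then for EVERY form `h'` of degree `m` in the letters `σ` and every weight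
`χ` of degree `d ≤ d₀`: `mult_χ k[\overline{GL_τ · x_t^e ι h'}] ≤ mult_χ k[Δ_{m+e}(P)]` — no weight of
degree `≤ d₀` is a multiplicity obstruction against `x_t^e ι h' ∈ Δ(P)`.  (`I(GL·P) ≤ I(GL · x_t^e ι h)`,
tree `orbitVanishingIdeal_le_of_mem_orbitClosure`, then §3 and rank–nullity.)  NOTE: only the
equation-freeness of `h` (the form INSIDE `Δ(P)`) is used, none of `h'`.
[cite: KadishLandsberg2014, Prop. 1.12 and §2] [cite: BurgisserEtAl2011, Prop. 6.3.2] -/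
theorem orbitMultiplicity_pad_le_of_mem_orbitClosure [CharZero k] (hι : Function.Injective ι)
    {t : τ} (ht : t ∉ Set.range ι) {m e d₀ : ℕ} (hme : m + e ≠ 0) {h : MvPolynomial σ k}
    (hh : h.IsHomogeneous m) (hE : IsEquationFreeUpTo h m d₀) {P : MvPolynomial τ k}
    (hP : X t ^ e * rename ι h ∈ orbitClosure P) {h' : MvPolynomial σ k} (hh' : h'.IsHomogeneous m)
    {d : ℕ} (hd : d ≤ d₀) {χ : Weight τ} (hχ : χ.size = -(((m + e) * d : ℕ) : ℤ)) :
    orbitMultiplicity k (X t ^ e * rename ι h') (m + e) χ ≤ orbitMultiplicity k P (m + e) χ := by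
  haveI : Infinite k := CharZero.infinite k
  refine orbitMultiplicity_le_of_hwv_inf_le hme fun F hF => ⟨hF.1, ?_⟩
  have hFd : F.IsHomogeneous d := isHomogeneous_of_mem_highestWeightSpace_of_size_eq hme hχ hF.1
  exact orbitVanishingIdeal_pad_le_of_isEquationFreeUpTo hι ht hh hh' hE hd hFd
    (orbitVanishingIdeal_le_of_mem_orbitClosure hP hF.2)

/-! ### §6 The multiplicity form of the hypothesis, and the cell's instance: `n × n` forms padded into
the `m × m` matrix space, against `det_m` (base field in `Type`, as the tree's partition-indexed
criteria `HwvIdealDegreeCriterion.lean`) -/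

section MatIdx

variable {k : Type} [Field k]

/-- **Multiplicity form of the hypothesis** (characteristic zero, `f` a form of degree `m ≠ 0`):
`Δ_m(f)` has no equations through degree `d₀` iff `mult_χ k[Δ_m(f)] = a_χ` (`plethysmCoeff`) for every
weight `χ` of degree `d ≤ d₀` (`|χ| = -m d`) — "the columns `⟨·,·,d⟩`, `d ≤ d₀`, are complete and
FULL".  The tree's `orbitVanishingIdeal_degree_eq_zero_iff` degree by degree.
[cite: BurgisserIkenmeyer2013, §3.3 Prop. 3.3] -/
theorem isEquationFreeUpTo_iff_forall_orbitMultiplicity_eq [CharZero k] {σ : Type} [Fintype σ]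
    [LinearOrder σ] {f : MvPolynomial σ k} {m : ℕ} (hm : m ≠ 0) (hf : f.IsHomogeneous m) (d₀ : ℕ) :
    IsEquationFreeUpTo f m d₀ ↔ ∀ d ≤ d₀, ∀ χ : Weight σ, χ.size = -((m * d : ℕ) : ℤ) →
      orbitMultiplicity k f m χ = plethysmCoeff k σ m χ := by
  constructor
  · intro H d hd χ hχ
    exact (orbitVanishingIdeal_degree_eq_zero_iff hm hf d).mp (fun Ψ hΨ hΨd => H hd hΨ hΨd) χ hχ
  · intro H d hd Ψ hΨ hΨd
    exact (orbitVanishingIdeal_degree_eq_zero_iff hm hf d).mpr (H d hd) Ψ hΨ hΨd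

/-- **The hypothesis for `det_n` from a table of per-type certificates** (the cell's record R1 in the
tree's indexation): if for every `d ≤ d₀` and every partition `λ ⊢ n d` with at most `n²` parts
`a_{λ*} ≤ mult_{λ*} k[Δ(det_n)]`, then `Δ(det_n)` (lexicographic matrix letters `MatIdx n`) has no
equations through degree `d₀`.  The tree's `orbitVanishingIdeal_det_degree_eq_zero_of_forall_partition`
degree by degree. [cite: BLMW2011, (5.2.2)] -/
theorem isEquationFreeUpTo_detFormLex_of_forall_partition [CharZero k] {n : ℕ} [NeZero n] {d₀ : ℕ}
    (H : ∀ d ≤ d₀, ∀ lam : Nat.Partition (n * d), lam.parts.card ≤ n * n →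
      plethysmCoeff k (MatIdx n) n (Weight.dualOfPartition (n * n) lam).toMatIdx ≤
        orbitMultiplicity k (detFormLex k n) n (Weight.dualOfPartition (n * n) lam).toMatIdx) :
    IsEquationFreeUpTo (detFormLex k n) n d₀ :=
  fun _ hd _ hΨ hΨd => orbitVanishingIdeal_det_degree_eq_zero_of_forall_partition (H _ hd) hΨ hΨd

/-- The placement of the `n × n` matrix letters (`MatIdx n`, lexicographic) as the bottom-right block of
the `m × m` matrix letters (`n ≤ m`; the tree's `blockEmb i = m - n + i` on both indices). [folklore] -/
def blockPlace {n m : ℕ} (hnm : n ≤ m) (x : MatIdx n) : MatIdx m :=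
  toLex (blockEmb hnm (ofLex x).1, blockEmb hnm (ofLex x).2)

/-- `blockPlace` is injective (the `n² + 1` letters `x₀₀`, block are distinct letters of the `m × m`
matrix, BLMW's `W' = ℂ^{m²+1} ⊂ W = ℂ^{n²}` with the roles of `n, m` swapped).
[cite: BurgisserEtAl2011, §6.3 (after Prop. 6.3.2)] -/
theorem blockPlace_injective {n m : ℕ} (hnm : n ≤ m) : Function.Injective (blockPlace hnm) := by
  intro x y hxy
  have h1 := congrArg (fun z : MatIdx m => ofLex z) hxy
  simp only [blockPlace, ofLex_toLex, Prod.mk.injEq] at h1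
  have h2 : ofLex x = ofLex y :=
    Prod.ext (blockEmb_injective hnm h1.1) (blockEmb_injective hnm h1.2)
  exact congrArg (fun z : Fin n × Fin n => toLex z) h2

/-- For `n < m` the padding letter `x₀₀` is not in the block ("`ℓ` a new variable").
[cite: BurgisserEtAl2011, §6.3 (after Prop. 6.3.2)] -/
theorem toLex_zero_not_mem_range_blockPlace {n m : ℕ} [NeZero m] (hnm : n < m) :
    toLex ((0 : Fin m), (0 : Fin m)) ∉ Set.range (blockPlace hnm.le) := by
  rintro ⟨x, hx⟩
  have h1 := congrArg (fun z : MatIdx m => ((ofLex z).1 : ℕ)) hx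
  simp only [blockPlace, ofLex_toLex, blockEmb_val, Fin.val_zero] at h1
  omega

/-- The generic determinant is natural under bijections of the index type. [folklore] -/
private theorem rename_prodMap_detPoly {α β : Type} [Fintype α] [DecidableEq α] [Fintype β] [DecidableEq β]
    (e : α ≃ β) : rename (Prod.map e e) (detPoly α k) = detPoly β k := by
  rw [detPoly, detPoly, AlgHom.map_det]
  have hM : (rename (Prod.map e e) : MvPolynomial (α × α) k →ₐ[k] MvPolynomial (β × β) k).mapMatrix
      (Matrix.mvPolynomialX α α k) = (Matrix.mvPolynomialX β β k).submatrix e e := by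
    ext i j : 1
    simp [Matrix.mvPolynomialX_apply, rename_X]
  rw [hM, Matrix.det_submatrix_equiv_self]

/-- The tree's padded permanent is the padded placement of `per_n` in its lexicographic `n × n` letters:
`paddedPerFormLex k n m = x₀₀^{m-n} · blockPlace(rename toLex per_n)` — BLMW's `ℓ^{n-m} per_m` on
the `m² + 1` letters `W'` placed in `W`. [cite: BurgisserEtAl2011, §6.3 (after Prop. 6.3.2)] -/
theorem paddedPerFormLex_eq_pad {n m : ℕ} [NeZero m] (hnm : n ≤ m) :
    paddedPerFormLex k n m =
      X (toLex ((0 : Fin m), (0 : Fin m))) ^ (m - n) *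
        rename (blockPlace hnm) (rename toLex (perPoly (Fin n) k)) := by
  rw [paddedPerFormLex, paddedPerPoly, map_mul, map_pow, rename_X, rename_rename, rename_rename,
    ← rename_perPoly_equiv (k := k) (blockEquiv hnm), rename_rename]
  rfl

/-- Likewise for the tree's padded determinant: `rename toLex (paddedDetPoly k n m) = x₀₀^{m-n} ·
blockPlace(det_n)` with `det_n = detFormLex k n` (ELSW's block restriction `R` of `det_m`).
[cite: EfremenkoLandsbergSchenckWeyman2018, §3 (Case C1)] -/
theorem rename_toLex_paddedDetPoly_eq_pad {n m : ℕ} [NeZero m] (hnm : n ≤ m) :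
    rename toLex (paddedDetPoly k n m) =
      X (toLex ((0 : Fin m), (0 : Fin m))) ^ (m - n) * rename (blockPlace hnm) (detFormLex k n) := by
  rw [paddedDetPoly, detFormLex, map_mul, map_pow, rename_X, rename_rename, rename_rename,
    ← rename_prodMap_detPoly (k := k) (blockEquiv hnm), rename_rename]
  rfl

/-- **The padded determinant lies in the orbit closure of `det_m`** in the lexicographic matrix letters:
`x₀₀^{m-n} · blockPlace(det_n) ∈ Δ(det_m)` (infinite field; tree `paddedDetPoly_mem_orbitClosure_detPoly`
= ELSW's `R ∈ End(W)·det_n`, transported along `rename toLex`).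
[cite: EfremenkoLandsbergSchenckWeyman2018, §3 (Case C1)] -/
theorem pad_detFormLex_mem_orbitClosure_detFormLex [Infinite k] {n m : ℕ} [NeZero m] (hnm : n ≤ m) :
    X (toLex ((0 : Fin m), (0 : Fin m))) ^ (m - n) * rename (blockPlace hnm) (detFormLex k n) ∈
      orbitClosure (detFormLex k m) := by
  rw [← rename_toLex_paddedDetPoly_eq_pad hnm]
  exact (rename_mem_orbitClosure_rename_iff_holds toLex (detPoly (Fin m) k) (paddedDetPoly k n m)).mpr
    (paddedDetPoly_mem_orbitClosure_detPoly n m)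

/-- **No multiplicity obstruction for (padded `n × n` form, `det_m`) below the first equation degree of
`Δ(det_n)`.**  Characteristic zero, `0 < n < m`.  HYPOTHESIS (the cell's record R1 in the tree's
indexation, cf. `orbitVanishingIdeal_det_degree_eq_zero_of_forall_partition`): for every `d ≤ d₀` and
every partition `λ ⊢ n d` with at most `n²` parts, `a_{λ*} ≤ mult_{λ*} k[Δ(det_n)]` (the `⟨n,n,d⟩`
det columns are FULL through degree `d₀`, i.e. `e(det_n) > d₀`).  CONCLUSION: for EVERY form `h'` of
degree `n` in the `n × n` matrix letters and every weight `χ` of `GL_{m²}` of degree `d ≤ d₀`: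
`mult_χ k[\overline{GL_{m²} · x₀₀^{m-n} h'}] ≤ mult_χ k[Δ(det_m)]` — by (A2) with `h = det_n`,
`P = det_m` (`x₀₀^{m-n} det_n ∈ End · det_m ⊆ Δ(det_m)`, tree `paddedDetPoly_mem_orbitClosure_detPoly`).
Cell reading (THEOREM V23, m = 3/n = 4 there ↔ n = 3/m = 4 here): below degree `e(det₃) = 10` no
multiplicity obstruction exists for `(x₀₀ · h', det₄)`, whatever the nine-letter cubic `h'`.
[cite: KadishLandsberg2014, Prop. 1.12 and §2] [cite: BurgisserEtAl2011, Prop. 6.3.2 and §6.3] -/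
theorem orbitMultiplicity_pad_le_detFormLex_of_forall_partition [CharZero k] {n m : ℕ} [NeZero n]
    [NeZero m] (hnm : n < m) {d₀ : ℕ}
    (H : ∀ d ≤ d₀, ∀ lam : Nat.Partition (n * d), lam.parts.card ≤ n * n →
      plethysmCoeff k (MatIdx n) n (Weight.dualOfPartition (n * n) lam).toMatIdx ≤
        orbitMultiplicity k (detFormLex k n) n (Weight.dualOfPartition (n * n) lam).toMatIdx)
    {h' : MvPolynomial (MatIdx n) k} (hh' : h'.IsHomogeneous n) {d : ℕ} (hd : d ≤ d₀)
    {χ : Weight (MatIdx m)} (hχ : χ.size = -((m * d : ℕ) : ℤ)) :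
    orbitMultiplicity k (X (toLex ((0 : Fin m), (0 : Fin m))) ^ (m - n) * rename (blockPlace hnm.le) h') m χ ≤
      orbitMultiplicity k (detFormLex k m) m χ := by
  haveI : Infinite k := CharZero.infinite k
  have hdeg : n + (m - n) = m := by omega
  have hgen := orbitMultiplicity_pad_le_of_mem_orbitClosure (blockPlace_injective hnm.le)
    (toLex_zero_not_mem_range_blockPlace hnm) (e := m - n) (by omega) (detFormLex_isHomogeneous k n)
    (isEquationFreeUpTo_detFormLex_of_forall_partition H)
    (pad_detFormLex_mem_orbitClosure_detFormLex hnm.le) hh' hd (χ := χ) (by rw [hdeg]; exact hχ)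
  rw [hdeg] at hgen
  exact hgen

/-- **The cell's V1 object.**  Under the same hypothesis on `det_n` (columns `⟨n,n,d⟩` FULL for
`d ≤ d₀`), for every partition `λ ⊢ m d`, `d ≤ d₀`, with at most `m²` parts:
`mult_{λ*} k[Δ(x₀₀^{m-n} per_n)] ≤ mult_{λ*} k[Δ(det_m)]` — the padded permanent admits NO multiplicity
obstruction against `det_m` in any degree `d ≤ d₀` (THEOREM V23 of the cell for `(n, m) = (3, 4)`,
`d₀ = 9`; honest framing: conditional on the measured record "e(det₃) = 10" entering as the hypothesis;
nothing here is a claim on VP vs VNP). [cite: KadishLandsberg2014, Prop. 1.12 and §2] [cite: BurgisserEtAl2011, Prop. 6.3.2 and §6.3] -/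
theorem orbitMultiplicity_paddedPerFormLex_le_detFormLex_of_forall_partition [CharZero k] {n m : ℕ}
    [NeZero n] [NeZero m] (hnm : n < m) {d₀ : ℕ}
    (H : ∀ d ≤ d₀, ∀ lam : Nat.Partition (n * d), lam.parts.card ≤ n * n →
      plethysmCoeff k (MatIdx n) n (Weight.dualOfPartition (n * n) lam).toMatIdx ≤
        orbitMultiplicity k (detFormLex k n) n (Weight.dualOfPartition (n * n) lam).toMatIdx)
    {d : ℕ} (hd : d ≤ d₀) (lam : Nat.Partition (m * d)) (hlam : lam.parts.card ≤ m * m) :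
    orbitMultiplicity k (paddedPerFormLex k n m) m (Weight.dualOfPartition (m * m) lam).toMatIdx ≤
      orbitMultiplicity k (detFormLex k m) m (Weight.dualOfPartition (m * m) lam).toMatIdx := by
  have hper : (rename toLex (perPoly (Fin n) k) : MvPolynomial (MatIdx n) k).IsHomogeneous n := by
    have h := (perPoly_isHomogeneous (n := Fin n) (k := k)).rename_isHomogeneous (f := toLex)
    rwa [Fintype.card_fin] at h
  rw [paddedPerFormLex_eq_pad hnm.le]
  exact orbitMultiplicity_pad_le_detFormLex_of_forall_partition hnm H hper hd
    (size_toMatIdx_dualOfPartition (m := m) lam hlam)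

end MatIdx

end Literature.Computability.AlgebraicComplexity
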